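import Summits.QuantumFields.GaugeBoot.ZdCentralTwistLoops
import Summits.QuantumFields.GaugeBoot.ClassBLinkCutWordBlocks
import HarnessLib

/-!
# The `ℤ^d` staggered central twist on lattice WORDS: the collected sign, its parity, invariance
# under the link reflection, and the parity of a cut-glued loop
(gauge-boot, L3 structural supplement; `ℤ^d` twist on words 1/2)

HONEST FRAMING (cell `pub-gaugeboot`, page 1 of every file): the venture produces certified bounds
on lattice expectations at stated coupling, gauge group, dimension and torus size; NOT a mass gap,
NOT a continuum limit, NOT a string tension; NOT Yang–Mills-summit-bearing (barriers
`FixedCouplingUltralocality`, `PerturbativeInvisibility`). This module bounds no expectation; no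
certificate of the cell sits at `β < 0`. Pure bookkeeping for the sequel
`LinkCutWordBlocksNegativeBeta.lean` (the sign-corrected Kazakov–Zheng cut-loop `R_link` blocks of
even-side limit points at `β < 0`).

`ZdCentralTwistWalks.lean` did this bookkeeping for Mathlib `SimpleGraph.Walk`s (`walkHolonomy`);
the cut-loop blocks of `ClassBLinkCutWordBlocks.lean` are written in the lane's `Word` /
`wordHolonomyZd` vocabulary (`LatticeWords`, `ClassBWords`), so the same elementary facts are
re-derived for words:

* `wordSign s x w` — the ordered product of the twist weights of the links traversed by the word
  `w` from `x`; `wordSign_append`, `wordSign_comm`; ★ `wordHolonomyZd_centralTwist` —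
  `hol_x(w)(T_s U) = wordSign s x w · hol_x(w)(U)` for central involutive weights;
* `twistParityZd π r x w = Σ_{links of w} c(l)` (`c` = `stagParity π r`, the Kogut–Susskind parity
  with the axis `r` last); `wordSign_stagTwist` (`wordSign (stagTwist π r z) = z^{twistParityZd}`);
  `twistParityZd_append`, `twistParityZd_reverse` (a reversed word collects the same parity);
* ★ `twistParityZd_map_flipAt` — **the link reflection `Θ_i` preserves the parity when `r = i`**:
  `twistParityZd π i (θ_i x) (flip_i w) = twistParityZd π i x w` (the parity of a link of direction
  `m ≠ i` reads only coordinates `m' < m`, `m' ≠ i`; that of an `i`-link reads all coordinates but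
  `x_i`; `θ_i` changes only `x_i`): `stagParity_eq_of_dualParity`, `edgeZd_flipAt_zdLinkReflect`;
* ★★ `twistParityZd_linkCutGlue` — the parity of the cut-glued loop
  `E_ab = [+e_i]_p · O_b · [-e_i] · (flip_i O_a)⁻¹` of `ClassBLinkCutWordBlocks.lean`
  (`p_i = q_i = 0`, `O_a, O_b : p + e_i → q + e_i`) is
  `c(p, i) + c(q, i) + twistParityZd (p + e_i) O_a + twistParityZd (p + e_i) O_b` — a sign
  `ε(p, q) · s_a · s_b` that FACTORISES over the block indices;
* `wordLoopZd_centralTwist_stagTwist` (`W_x(w)(T U) = (-1)^{twistParityZd} W_x(w)(U)` for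
  `ρ z = -1`), `integral_wordLoopZd_map_centralTwist`.

Elementary; [folklore] bookkeeping (Kogut–Susskind 1975; Li–Meurice, Phys. Rev. D 71 (2005) 016008
§II).
-/

noncomputable section

open MeasureTheory
open Literature.Probability.LatticeModels (Site)
open Literature.MathematicalPhysics.QuantumLattice

namespace Summit.QuantumFields.GaugeBoot

namespace TiltedRP

variable {d N : ℕ} {G : Type*} [Group G]

/-! ## Edges of steps -/

section Edges

omit [Group G] in
/-- The reverse step, taken from the endpoint, traverses the same `ℤ^d` edge. -/
theorem edgeZd_inv_applyZd (x : Site d) (st : Step d) : st.inv.edgeZd (st.applyZd x) = st.edgeZd x := by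
  cases st <;> simp [Step.edgeZd, Step.applyZd, Step.inv]

omit [Group G] in
/-- **The reflected step traverses a link of the same direction with the same coordinates off the
axis `i`**: for the link reflection `θ_i` (`zdLinkReflect i`) and the reflected step `flip_i st`
taken from `θ_i x`, the traversed edge has the direction of `st.edgeZd x` and the same `m`-th
coordinate of its source for every `m ≠ i`. -/
theorem edgeZd_flipAt_zdLinkReflect (i : Fin d) (x : Site d) (st : Step d) :
    ((st.flipAt i).edgeZd (zdLinkReflect i x)).2 = (st.edgeZd x).2 ∧
      ∀ m, m ≠ i → ((st.flipAt i).edgeZd (zdLinkReflect i x)).1 m = (st.edgeZd x).1 m := by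
  cases st with
  | fwd μ =>
    by_cases h : μ = i
    · subst h
      refine ⟨by simp, fun m hm => ?_⟩
      simp [zdLinkReflect, Function.update_of_ne hm, Pi.single_eq_of_ne hm]
    · refine ⟨by simp [Step.flipAt_fwd_of_ne h], fun m hm => ?_⟩
      simp [Step.flipAt_fwd_of_ne h, zdLinkReflect, Function.update_of_ne hm]
  | bwd μ =>
    by_cases h : μ = i
    · subst h
      refine ⟨by simp, fun m hm => ?_⟩
      simp [zdLinkReflect, Function.update_of_ne hm, Pi.single_eq_of_ne hm]
    · refine ⟨by simp [Step.flipAt_bwd_of_ne h], fun m hm => ?_⟩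
      simp [Step.flipAt_bwd_of_ne h, zdLinkReflect, Function.update_of_ne hm]

end Edges

/-! ## The weight a word collects under a central twist -/

section WordSign

/-- **The twist weight collected by a word**: the ordered product of the weights `s(l)` of the
(positively oriented) links traversed by `w` started at `x`, with multiplicity. -/
def wordSign (s : ZdEdge d → G) : Site d → Word d → G
  | _, [] => 1
  | x, st :: w => s (st.edgeZd x) * wordSign s (st.applyZd x) w

/-- Unfolding lemma. -/
@[simp] theorem wordSign_nil (s : ZdEdge d → G) (x : Site d) : wordSign s x ([] : Word d) = 1 := rfl

/-- Unfolding lemma. -/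
@[simp] theorem wordSign_cons (s : ZdEdge d → G) (x : Site d) (st : Step d) (w : Word d) :
    wordSign s x (st :: w) = s (st.edgeZd x) * wordSign s (st.applyZd x) w := rfl

/-- The collected weight is multiplicative under concatenation. -/
theorem wordSign_append (s : ZdEdge d → G) :
    ∀ (x : Site d) (v w : Word d),
      wordSign s x (v ++ w) = wordSign s x v * wordSign s (Word.endpointZd x v) w
  | x, [], w => by simp
  | x, st :: v, w => by
    rw [List.cons_append, wordSign_cons, wordSign_cons, Word.endpointZd_cons, wordSign_append s _ v w,
      mul_assoc]

variable {s : ZdEdge d → G}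

/-- For central weights the collected weight is central. -/
theorem wordSign_comm (hc : ∀ l g, s l * g = g * s l) :
    ∀ (x : Site d) (w : Word d) (g : G), wordSign s x w * g = g * wordSign s x w
  | x, [], g => by simp
  | x, st :: w, g => by
    rw [wordSign_cons, mul_assoc, wordSign_comm hc _ w g, ← mul_assoc, hc, mul_assoc]

/-- One step under the twist: `hol(T_s U) = s(l) · hol(U)` for the traversed link `l` (central
involutive weights; for a backward step `(s U)⁻¹ = U⁻¹ s⁻¹ = s U⁻¹`). -/
theorem stepHolonomyZd_centralTwist (hc : ∀ l g, s l * g = g * s l) (h2 : ∀ l, s l * s l = 1)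
    (U : LGConfig d G) (x : Site d) (st : Step d) :
    stepHolonomyZd (centralTwist s U) x st = s (st.edgeZd x) * stepHolonomyZd U x st := by
  cases st with
  | fwd μ => rfl
  | bwd μ =>
    simp only [stepHolonomyZd_bwd, Step.edgeZd_bwd, centralTwist_apply, mul_inv_rev]
    rw [inv_eq_of_mul_eq_one_right (h2 _), hc]

/-- ★ **The word holonomy under a central involutive twist**:
`hol_x(w)(T_s U) = wordSign s x w · hol_x(w)(U)`. -/
theorem wordHolonomyZd_centralTwist (hc : ∀ l g, s l * g = g * s l) (h2 : ∀ l, s l * s l = 1)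
    (U : LGConfig d G) :
    ∀ (x : Site d) (w : Word d),
      wordHolonomyZd (centralTwist s U) x w = wordSign s x w * wordHolonomyZd U x w
  | x, [] => by simp
  | x, st :: w => by
    rw [wordHolonomyZd_cons, wordHolonomyZd_cons, wordSign_cons, stepHolonomyZd_centralTwist hc h2,
      wordHolonomyZd_centralTwist hc h2 U (st.applyZd x) w]
    set W := wordSign s (st.applyZd x) w
    set h := stepHolonomyZd U x st
    set H := wordHolonomyZd U (st.applyZd x) w
    calc s (st.edgeZd x) * h * (W * H) = s (st.edgeZd x) * (h * W) * H := by simp only [mul_assoc]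
      _ = s (st.edgeZd x) * (W * h) * H := by rw [wordSign_comm hc]
      _ = s (st.edgeZd x) * W * (h * H) := by simp only [mul_assoc]

end WordSign

/-! ## The collected parity of a staggered twist -/

section Parity

variable {π : Fin d → Site d →+ ZMod 2} {z : G}

/-- **The parity a word collects under the staggered twist** `stagTwist π r z`:
`Σ_{links l of w} c(l)`, `c = stagParity π r`. -/
def twistParityZd (π : Fin d → Site d →+ ZMod 2) (r : Fin d) : Site d → Word d → ZMod 2
  | _, [] => 0
  | x, st :: w => stagParity π r (st.edgeZd x) + twistParityZd π r (st.applyZd x) w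

/-- Unfolding lemma. -/
@[simp] theorem twistParityZd_nil (r : Fin d) (x : Site d) :
    twistParityZd π r x ([] : Word d) = 0 := rfl

/-- Unfolding lemma. -/
@[simp] theorem twistParityZd_cons (r : Fin d) (x : Site d) (st : Step d) (w : Word d) :
    twistParityZd π r x (st :: w) = stagParity π r (st.edgeZd x) + twistParityZd π r (st.applyZd x) w :=
  rfl

/-- **The collected weight of the staggered twist is `z^{twistParityZd}`** (`z² = 1`). -/
theorem wordSign_stagTwist (hz2 : z * z = 1) (π : Fin d → Site d →+ ZMod 2) (r : Fin d) :
    ∀ (x : Site d) (w : Word d), wordSign (stagTwist π r z) x w = zpow₂ z (twistParityZd π r x w)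
  | x, [] => by simp [zpow₂]
  | x, st :: w => by
    rw [wordSign_cons, twistParityZd_cons, zpow₂_add hz2, wordSign_stagTwist hz2 π r (st.applyZd x) w]
    rfl

/-- The collected parity is additive under concatenation. -/
theorem twistParityZd_append (r : Fin d) :
    ∀ (x : Site d) (v w : Word d),
      twistParityZd π r x (v ++ w) = twistParityZd π r x v + twistParityZd π r (Word.endpointZd x v) w
  | x, [], w => by simp
  | x, st :: v, w => by
    rw [List.cons_append, twistParityZd_cons, twistParityZd_cons, Word.endpointZd_cons,
      twistParityZd_append r _ v w, add_assoc]

/-- **A reversed word collects the same parity** (each link is read once either way). -/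
theorem twistParityZd_reverse (r : Fin d) :
    ∀ (x : Site d) (w : Word d),
      twistParityZd π r (Word.endpointZd x w) (Word.reverse w) = twistParityZd π r x w
  | x, [] => rfl
  | x, st :: w => by
    rw [Word.endpointZd_cons, Word.reverse_cons, twistParityZd_append,
      twistParityZd_reverse r (st.applyZd x) w, Word.endpointZd_reverse, twistParityZd_cons,
      twistParityZd_cons, twistParityZd_nil, add_zero, edgeZd_inv_applyZd, add_comm]

/-- **The Kogut–Susskind parity with the axis `r` last reads only the coordinates `≠ r` (mod 2)**:
two links of the same direction whose sources agree mod 2 off the axis `r` have the same parity. -/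
theorem stagParity_eq_of_dualParity (hπ : IsDualParity (zdUnit d) π) (r : Fin d) {e e' : ZdEdge d}
    (h2 : e.2 = e'.2) (h1 : ∀ m, m ≠ r → (e.1 m : ZMod 2) = (e'.1 m : ZMod 2)) :
    stagParity π r e = stagParity π r e' := by
  unfold stagParity
  rw [h2]
  refine Finset.sum_congr rfl fun m hm => ?_
  have hm' : m ≠ r := (Finset.mem_filter.1 hm).2.1
  rw [hπ.apply_zd, hπ.apply_zd, h1 m hm']

/-- ★ **The link reflection `Θ_i` preserves the collected parity of the twist with `i` last**:
`twistParityZd π i (θ_i x) (flip_i w) = twistParityZd π i x w`. -/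
theorem twistParityZd_map_flipAt (hπ : IsDualParity (zdUnit d) π) (i : Fin d) :
    ∀ (x : Site d) (w : Word d),
      twistParityZd π i (zdLinkReflect i x) (w.map (Step.flipAt i)) = twistParityZd π i x w
  | x, [] => rfl
  | x, st :: w => by
    rw [List.map_cons, twistParityZd_cons, twistParityZd_cons, ← zdLinkReflect_applyZd,
      twistParityZd_map_flipAt hπ i (st.applyZd x) w]
    congr 1
    obtain ⟨h2, h1⟩ := edgeZd_flipAt_zdLinkReflect i x st
    exact stagParity_eq_of_dualParity hπ i h2 fun m hm => by rw [h1 m hm]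

/-- ★★ **The parity of the cut-glued loop factorises.** For the loop
`E_ab = [+e_i]_p · O_b · [-e_i] · (flip_i O_a)⁻¹` of `ClassBLinkCutWordBlocks.lean` (`p_i = q_i = 0`,
half-words `O_a, O_b : p + e_i → q + e_i`), the collected parity of the twist with `i` last is
`c(p, i) + c(q, i) + twistParityZd (p + e_i) O_a + twistParityZd (p + e_i) O_b`. -/
theorem twistParityZd_linkCutGlue (hπ : IsDualParity (zdUnit d) π) {i : Fin d} {p q : Site d}
    (hp : p i = 0) (hq : q i = 0) {Oa Ob : Word d}
    (ha : Word.endpointZd (p + Pi.single i 1) Oa = q + Pi.single i 1)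
    (hb : Word.endpointZd (p + Pi.single i 1) Ob = q + Pi.single i 1) :
    twistParityZd π i p (Step.fwd i :: (Ob ++ Step.bwd i :: Word.reverse (Oa.map (Step.flipAt i)))) =
      stagParity π i (p, i) + stagParity π i (q, i) + twistParityZd π i (p + Pi.single i 1) Oa +
        twistParityZd π i (p + Pi.single i 1) Ob := by
  rw [twistParityZd_cons, Step.edgeZd_fwd, Step.applyZd_fwd, twistParityZd_append, hb,
    twistParityZd_cons, Step.edgeZd_bwd, Step.applyZd_bwd]
  have hq' : q + Pi.single i (1 : ℤ) - Pi.single i 1 = q := by simp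
  rw [hq']
  have hend : Word.endpointZd p (Oa.map (Step.flipAt i)) = q := by
    have h := Word.endpointZd_map_flipAt_link i (p + Pi.single i 1) Oa
    rw [zdLinkReflect_add_single_of_apply_eq_zero hp, ha,
      zdLinkReflect_add_single_of_apply_eq_zero hq] at h
    exact h
  have hrev : twistParityZd π i q (Word.reverse (Oa.map (Step.flipAt i))) =
      twistParityZd π i p (Oa.map (Step.flipAt i)) := by
    rw [← hend]
    exact twistParityZd_reverse i p _
  have hflip : twistParityZd π i p (Oa.map (Step.flipAt i)) =
      twistParityZd π i (p + Pi.single i 1) Oa := by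
    have h := twistParityZd_map_flipAt hπ i (p + Pi.single i 1) Oa
    rwa [zdLinkReflect_add_single_of_apply_eq_zero hp] at h
  rw [hrev, hflip]
  abel

/-- **With the coordinate parities, `c(p, i) = Σ_{m ≠ i} p_m (mod 2)`** for an `i`-link `(p, i)`. -/
theorem stagParity_self_eq_sum (hπ : IsDualParity (zdUnit d) π) (i : Fin d) (p : Site d) :
    stagParity π i (p, i) = ∑ m ∈ Finset.univ.filter (· ≠ i), (p m : ZMod 2) := by
  unfold stagParity
  have hfilter : (Finset.univ.filter fun m' => PrecLast i m' i) = Finset.univ.filter (· ≠ i) := by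
    ext m; simp [PrecLast]
  rw [hfilter]
  exact Finset.sum_congr rfl fun m _ => hπ.apply_zd m p

end Parity

/-! ## Loop variables under the twist -/

section Loops

variable {π : Fin d → Site d →+ ZMod 2} {z : G}
variable [TopologicalSpace G] [IsTopologicalGroup G] [CompactSpace G] [MeasurableSpace G]
  [BorelSpace G] (ρ : G →* Matrix (Fin N) (Fin N) ℂ)

omit [TopologicalSpace G] [IsTopologicalGroup G] [CompactSpace G] [MeasurableSpace G]
  [BorelSpace G] in
/-- ★ **`W_x(w)(T U) = (-1)^{twistParityZd π r x w} · W_x(w)(U)`** for the loop variable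
`W = (1/N) Re tr ρ` (`ρ z = -1`, `z` central with `z² = 1`; every word, closed or not). -/
theorem wordLoopZd_centralTwist_stagTwist (hπ : IsDualParity (zdUnit d) π)
    (hzc : ∀ g : G, z * g = g * z) (hz2 : z * z = 1) (hρz : ρ z = -1) (r : Fin d) (x : Site d)
    (w : Word d) (U : LGConfig d G) :
    wordLoopZd ρ x w (centralTwist (stagTwist π r z) U) =
      (-1 : ℝ) ^ (twistParityZd π r x w).val * wordLoopZd ρ x w U := by
  have hs := isStaggering_stagTwist (G := G) (e := zdUnit d) hπ r hzc hz2
  simp only [wordLoopZd_apply]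
  rw [wordHolonomyZd_centralTwist hs.comm hs.mul_self U x w, wordSign_stagTwist hz2 π r x w, map_mul,
    rep_zpow₂ ρ hρz, smul_mul_assoc, one_mul, Matrix.trace_smul, Complex.smul_re, smul_eq_mul]
  ring

omit [CompactSpace G] in
/-- **`∫ W_x(w) d(μ ∘ T⁻¹) = (-1)^{twistParityZd} ∫ W_x(w) dμ`** for every measure `μ` on `ℤ^d`
configurations and every word (`ρ` continuous with `ρ z = -1`). -/
theorem integral_wordLoopZd_map_centralTwist [SecondCountableTopology G] (hπ : IsDualParity (zdUnit d) π)
    (hzc : ∀ g : G, z * g = g * z) (hz2 : z * z = 1) (hρ : Continuous ρ) (hρz : ρ z = -1)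
    (r : Fin d) (μ : Measure (LGConfig d G)) (x : Site d) (w : Word d) :
    ∫ U, wordLoopZd ρ x w U ∂(μ.map (centralTwist (stagTwist π r z))) =
      (-1 : ℝ) ^ (twistParityZd π r x w).val * ∫ U, wordLoopZd ρ x w U ∂μ := by
  rw [integral_map_centralTwist _ μ (continuous_wordLoopZd hρ x w), ← integral_const_mul]
  exact integral_congr_ae (ae_of_all _ fun U =>
    wordLoopZd_centralTwist_stagTwist ρ hπ hzc hz2 hρz r x w U)

end Loops

end TiltedRP

end Summit.QuantumFields.GaugeBoot
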